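import Mathlib

/-!
# Line `Sketch` for crux `FidelityWitnesses.FidelityThesis` (stmt-MatrixMultiplication-4956) —
stub `stub_weylParseval`: Plancherel for the ambiguity function on `ℤ/N`

For `ψ : ℤ/N → ℂ` put `A_ψ(s,t) = ∑_b conj(ψ b) ψ(b − s) e(tb)` with `e = ZMod.stdAddChar` the standard
additive character `j ↦ exp(2πi j/N)`.  The `N²` Weyl operators `Z^t X^s` form an orthogonal basis of
`N × N` matrices; equivalently `∑_{s,t} |A_ψ(s,t)|² = N ‖ψ‖⁴`, which is what `stub_weylParseval` states.

Proof: for fixed `s` put `f_s(b) = conj(ψ b) ψ(b − s)`; Parseval on `ℤ/N` (character orthogonality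
`∑_t e(t d) = N·[d = 0]`, `AddChar.sum_mulShift` with `ZMod.isPrimitive_stdAddChar`) gives
`∑_t |∑_b f_s(b) e(tb)|² = N ∑_b |f_s(b)|² = N ∑_b |ψ b|² |ψ(b − s)|²`, and summing over `s` after the
reindexing `s ↦ b − s` yields `N (∑_b |ψ b|²)²`.
Supports item `stmt-MatrixMultiplication-4956`; Mathlib only, no definitions.
-/

namespace Summit.MatrixMultiplication.MatrixMultiplication.Theorems

open scoped BigOperators ComplexConjugate

/-- Orthogonality of the standard additive character of `ℤ/N`: `∑_t e(t·d) = N` if `d = 0` and `0`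
otherwise. [folklore] -/
private theorem weylParseval_sum_stdAddChar {N : ℕ} [NeZero N] (d : ZMod N) :
    ∑ t : ZMod N, (ZMod.stdAddChar (t * d) : ℂ) = if d = 0 then (N : ℂ) else 0 := by
  classical
  rw [AddChar.sum_mulShift d (ZMod.isPrimitive_stdAddChar N), ZMod.card]
  split_ifs <;> simp

/-- **Parseval on `ℤ/N`**: `∑_t ‖∑_b f(b) e(t·b)‖² = N ∑_b ‖f b‖²`. [folklore] -/
private theorem weylParseval_parseval {N : ℕ} [NeZero N] (f : ZMod N → ℂ) :
    ∑ t : ZMod N, ‖∑ b : ZMod N, f b * (ZMod.stdAddChar (t * b) : ℂ)‖ ^ 2 =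
      (N : ℝ) * ∑ b, ‖f b‖ ^ 2 := by
  -- complex form of each summand: `|F(t)|² = ∑_{b,b'} f b conj(f b') e(t (b - b'))`
  have key : ∀ t : ZMod N, ((‖∑ b : ZMod N, f b * (ZMod.stdAddChar (t * b) : ℂ)‖ : ℝ) : ℂ) ^ 2 =
      ∑ b : ZMod N, ∑ b' : ZMod N,
        f b * conj (f b') * (ZMod.stdAddChar (t * (b - b')) : ℂ) := by
    intro t
    rw [← Complex.mul_conj', map_sum, Finset.sum_mul_sum]
    refine Finset.sum_congr rfl fun b _ => Finset.sum_congr rfl fun b' _ => ?_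
    rw [map_mul (starRingEnd ℂ), ← AddChar.map_neg_eq_conj, mul_sub, sub_eq_add_neg,
      AddChar.map_add_eq_mul]
    ring
  apply Complex.ofReal_injective
  push_cast
  simp_rw [key]
  calc ∑ t : ZMod N, ∑ b : ZMod N, ∑ b' : ZMod N,
        f b * conj (f b') * (ZMod.stdAddChar (t * (b - b')) : ℂ)
      = ∑ b : ZMod N, ∑ b' : ZMod N,
          f b * conj (f b') * ∑ t : ZMod N, (ZMod.stdAddChar (t * (b - b')) : ℂ) := by
        rw [Finset.sum_comm]
        refine Finset.sum_congr rfl fun b _ => ?_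
        rw [Finset.sum_comm]
        refine Finset.sum_congr rfl fun b' _ => ?_
        rw [Finset.mul_sum]
    _ = ∑ b : ZMod N, f b * conj (f b) * (N : ℂ) := by
        refine Finset.sum_congr rfl fun b _ => ?_
        simp_rw [weylParseval_sum_stdAddChar, sub_eq_zero, mul_ite, mul_zero]
        rw [Fintype.sum_ite_eq]
    _ = (N : ℂ) * ∑ b : ZMod N, ((‖f b‖ : ℝ) : ℂ) ^ 2 := by
        rw [Finset.mul_sum]
        refine Finset.sum_congr rfl fun b _ => ?_
        rw [Complex.mul_conj']
        ring

/-- **Plancherel for the ambiguity function** (`stub_weylParseval`): for `ψ : ℤ/N → ℂ`,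
`∑_{s,t} |∑_b conj(ψ b) ψ(b − s) e(t b)|² = N (∑_b |ψ b|²)²`, `e = ZMod.stdAddChar`; i.e. the `N²`
Weyl operators `Z^t X^s` are an orthogonal basis of matrices.  Parseval in `t` for
`f_s(b) = conj(ψ b) ψ(b − s)`, then `∑_s ∑_b |ψ b|²|ψ(b − s)|² = (∑_b |ψ b|²)²` by `s ↦ b − s`. [folklore] -/
theorem stub_weylParseval {N : ℕ} [NeZero N] (ψ : ZMod N → ℂ) :
    ∑ s : ZMod N, ∑ t : ZMod N,
        ‖∑ b : ZMod N, conj (ψ b) * ψ (b - s) * (ZMod.stdAddChar (t * b) : ℂ)‖ ^ 2 =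
      (N : ℝ) * (∑ b, ‖ψ b‖ ^ 2) ^ 2 := by
  have h1 : ∀ s : ZMod N, ∑ t : ZMod N,
      ‖∑ b : ZMod N, conj (ψ b) * ψ (b - s) * (ZMod.stdAddChar (t * b) : ℂ)‖ ^ 2 =
      (N : ℝ) * ∑ b, ‖ψ b‖ ^ 2 * ‖ψ (b - s)‖ ^ 2 := by
    intro s
    rw [weylParseval_parseval (fun b => conj (ψ b) * ψ (b - s))]
    congr 1
    refine Finset.sum_congr rfl fun b _ => ?_
    rw [norm_mul, mul_pow, Complex.norm_conj]
  simp_rw [h1]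
  rw [← Finset.mul_sum]
  congr 1
  rw [Finset.sum_comm, sq, Finset.sum_mul]
  refine Finset.sum_congr rfl fun b _ => ?_
  rw [← Finset.mul_sum]
  congr 1
  exact Equiv.sum_comp (Equiv.subLeft b) (fun s => ‖ψ s‖ ^ 2)

end Summit.MatrixMultiplication.MatrixMultiplication.Theorems
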